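import Summits.KontsevichZagierPeriods.KontsevichZagierPeriods.Theorems.RootDecompRationalCubeDichotomyEtaleCubeBypassP1

/-! # `RootDecompRationalCubeDichotomyEtaleCubeBypass` — part 2/2 of the mechanical ≤380-line split of `src.lean`
(split by the decomp-kz census seat for landing; mathematics unchanged; part 2 continues part 1). -/

noncomputable section
set_option linter.dupNamespace false
set_option linter.unusedVariables false

namespace Summit.KontsevichZagierPeriods.RootDecompRationalCubeDichotomy.Rung24903.EtaleBypass
open MeasureTheory Set MvPolynomial
open Literature.NumberTheory.Transcendental Literature.NumberTheory.Transcendental.KZ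
open Literature.ModelTheory.ExponentialFields (IsSemialgebraic)
open Summit.KontsevichZagierPeriods.KontsevichZagierPeriods.Theses.RootDecompRationalCubeDichotomy
open Summit.KontsevichZagierPeriods.RootDecompRationalCubeDichotomy.RungEtale.Etale
  (piIter_sum piRationalisationGlue_proof piRationalisation_of_nashEtaleCover piRationalisationEtale_proof)
open Summit.KontsevichZagierPeriods.RootDecompRationalCubeDichotomy.Rung27842.SimpleBranch (isSemialgebraic_ratBox)
open Summit.KontsevichZagierPeriods.RootDecompRationalCubeDichotomy.Rung29430.NashEtaleLocalGlue
  (nashEtaleCover_of_nashEtaleLocal dist_corner_le corner_mem_cube)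
open Summit.KontsevichZagierPeriods.RootDecompRationalCubeDichotomy.Rung29430.MultiGen
  (LocalDataAt MultiGenData CollapseAt)

/-- Consistency: the bypass theorem re-derives the old one (the new piece sits BELOW the old AND-node). -/
theorem closes_of_cover' (hN : CubeNashNormalForm) (hCov : NashEtaleCover) (hA : RationalCubePiKernel)
    (hC : KontsevichZagierPeriods.Theses.RootDecompRationalCubeDichotomy.PiCancellation) : _root_.KontsevichZagierPeriods :=
  closes_etale (cubeEtaleNormalForm_of_cover hN hCov) hA hC

/-! ### §2  The prover-facing leaf: pointwise multi-generator presentations on the closed cube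

`PresentedOnCube n g`: at every point of the closed unit cube, `g` carries a `MultiGenData` presentation
(landed `…NashMultiGenP01`: ℚ-Nash generators `u₁ … u_k` solving an étale system `F(x,u) = 0`,
`det ∂_u F ≠ 0` at the point, `g = A(x,u)/B(x,u)` nearby).  This is the form in which the presented-germ
calculus (§3) delivers its output; the kit's `CollapseAt n` (k generators ⟹ 1, g8 `collapseAt_holds`,
landing as part P07) and a Lebesgue number turn it into `EtaleCoverAt`. -/

/-- Pointwise multi-generator étale presentation of `g` on the closed unit cube of `ℝⁿ`. -/
def PresentedOnCube (n : ℕ) (g : (Fin n → ℝ) → ℝ) : Prop :=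
  ∀ x₀ ∈ Set.pi Set.univ (fun _ : Fin n => Set.Icc (0:ℝ) 1), ∃ k, MultiGenData n k g x₀

/-- **Lebesgue step, per integrand.**  Single-branch data at every point of the closed cube give an étale
grid cover (`EtaleCoverAt`): Lebesgue number of the pointwise cover in the sup metric, any mesh below it.
(Per-`g` copy of the landed `nashEtaleCover_of_nashEtaleLocal`.) [folklore] -/
theorem etaleCoverAt_of_localData {n : ℕ} {g : (Fin n → ℝ) → ℝ}
    (hloc : ∀ x₀ ∈ Set.pi Set.univ (fun _ : Fin n => Set.Icc (0:ℝ) 1), LocalDataAt n g x₀) :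
    EtaleCoverAt n g := by
  choose V h F A B hV using hloc
  have hKc : IsCompact (Set.pi Set.univ (fun _ : Fin n => Set.Icc (0:ℝ) 1)) :=
    isCompact_univ_pi fun _ => isCompact_Icc
  obtain ⟨δ, hδ, hcov⟩ := lebesgue_number_lemma_of_metric hKc
    (c := fun i : Set.pi Set.univ (fun _ : Fin n => Set.Icc (0:ℝ) 1) => V i.1 i.2)
    (fun i => (hV i.1 i.2).1)
    (fun x hx => Set.mem_iUnion.mpr ⟨⟨x, hx⟩, (hV x hx).2.1⟩)
  obtain ⟨N, hN⟩ := exists_nat_one_div_lt hδ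
  refine ⟨N + 1, Nat.succ_pos N, fun κ => ?_⟩
  obtain ⟨i, hi⟩ := hcov _ (corner_mem_cube κ)
  have hbox : Set.pi Set.univ (fun j : Fin n =>
      Set.Icc ((((κ j : ℕ) : ℝ)) / ((N + 1 : ℕ) : ℝ)) ((((κ j : ℕ) : ℝ) + 1) / ((N + 1 : ℕ) : ℝ))) ⊆ V i.1 i.2 :=
    fun x hx => hi (Metric.mem_ball.mpr (lt_of_le_of_lt (dist_corner_le κ hx) hN))
  exact ⟨V i.1 i.2, h i.1 i.2, F i.1 i.2, A i.1 i.2, B i.1 i.2, (hV i.1 i.2).1, hbox,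
    (hV i.1 i.2).2.2.1, (hV i.1 i.2).2.2.2.1, fun x hx => (hV i.1 i.2).2.2.2.2 x (hbox hx)⟩

/-- `PresentedOnCube ⟹ EtaleCoverAt`, modulo the kit's collapse `CollapseAt n` (proved for every `n` in
the lens kernel g8 §2d `collapseAt_holds`; standard-étale collapse, Stacks 00UE). -/
theorem etaleCoverAt_of_presented {n : ℕ} (hcol : CollapseAt n) {g : (Fin n → ℝ) → ℝ}
    (hP : PresentedOnCube n g) : EtaleCoverAt n g :=
  etaleCoverAt_of_localData fun x₀ hx₀ => by
    obtain ⟨k, hk⟩ := hP x₀ hx₀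
    exact hcol g x₀ k hk

/-- **The prover-facing leaf `CubePointwiseEtaleNormalForm`**: cube–Nash normal form whose output
integrands are presented (`MultiGenData`) at every point of their closed cubes.  THIS is what the
presented-germ calculus of §3 run along the landed Jung line produces. -/
def CubePointwiseEtaleNormalForm : Prop :=
  ∀ (k k' : ℕ) (r : IntegralRep k) (r' : IntegralRep k'), r.IsRational → r'.IsRational →
    ∃ (S : ℕ) (n : Fin S → ℕ) (g : (i : Fin S) → (Fin (n i) → ℝ) → ℝ) (U : (i : Fin S) → Set (Fin (n i) → ℝ))
      (ε : Fin S → ℤ) (s : (i : Fin S) → IntegralRep (n i)),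
      (∀ i, IsOpen (U i) ∧ Set.pi Set.univ (fun _ : Fin (n i) => Set.Icc (0:ℝ) 1) ⊆ (U i) ∧
        IsSemialgebraicFunOn ℚ (U i) (g i) ∧ AnalyticOnNhd ℝ (g i) (U i) ∧ PresentedOnCube (n i) (g i)) ∧
      (∀ i, (s i).domain = Set.pi Set.univ (fun _ : Fin (n i) => Set.Icc (0:ℝ) 1) ∧
        ∀ z ∈ Set.pi Set.univ (fun _ : Fin (n i) => Set.Icc (0:ℝ) 1), (s i).integrand z = g i z) ∧
      of r - of r' - ∑ i, ε i • of (s i) ∈ relations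

/-- Pointwise form ⟹ grid form, modulo collapse in every dimension. -/
theorem cubeEtaleNormalForm_of_pointwise (hcol : ∀ n, CollapseAt n) (hP : CubePointwiseEtaleNormalForm) :
    CubeEtaleNormalForm := by
  intro k k' r r' hr hr'
  obtain ⟨S, n, g, U, ε, s, hg, hs, hrel⟩ := hP k k' r r' hr hr'
  exact ⟨S, n, g, U, ε, s, fun i => ⟨(hg i).1, (hg i).2.1, (hg i).2.2.1, (hg i).2.2.2.1,
    etaleCoverAt_of_presented (hcol (n i)) (hg i).2.2.2.2⟩, hs, hrel⟩

/-- The deciding theorem from the prover-facing leaf (collapse by name once part P07 lands: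
`fun n => MultiGen.collapseAt_holds n`). -/
theorem closes_pointwise (hcol : ∀ n, CollapseAt n) (hP : CubePointwiseEtaleNormalForm)
    (hA : RationalCubePiKernel) (hC : KontsevichZagierPeriods.Theses.RootDecompRationalCubeDichotomy.PiCancellation) : _root_.KontsevichZagierPeriods :=
  closes_etale (cubeEtaleNormalForm_of_pointwise hcol hP) hA hC

/-! ### §3  Typed primitives of the presented-germ calculus (the leaf's stub signatures; no proofs here)

All over the landed `MultiGenData`.  Paper proofs in the docstrings; each is elementary (implicit-function
kit `NashImplicitK.exists_implicit` / `solutions_eq_near` of the lens kernel + polynomial identities). -/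

/-- **P1 `PresentedMul n` — closure under product** (and likewise sum): concatenate the generator systems
(block-diagonal Jacobian), multiply the fractions.  Size S–M (Fin (k+k') bookkeeping, `Matrix.fromBlocks`
determinant). -/
def PresentedMul (n : ℕ) : Prop :=
  ∀ (k k' : ℕ) (f g : (Fin n → ℝ) → ℝ) (x₀ : Fin n → ℝ), MultiGenData n k f x₀ → MultiGenData n k' g x₀ →
    ∃ k'', MultiGenData n k'' (fun x => f x * g x) x₀

/-- **P2 `PresentedAdd n` — closure under sum.** -/
def PresentedAdd (n : ℕ) : Prop :=
  ∀ (k k' : ℕ) (f g : (Fin n → ℝ) → ℝ) (x₀ : Fin n → ℝ), MultiGenData n k f x₀ → MultiGenData n k' g x₀ →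
    ∃ k'', MultiGenData n k'' (fun x => f x + g x) x₀

/-- **P3 `PresentedComp n m` — closure under composition with presented maps.**  If `f` is presented at
`Φ x₀` and every component `Φ j` is presented at `x₀`, then `f ∘ Φ` is presented at `x₀`: generators
`(t, X, y)` = (generators of the `Φ j`, new generators `X_j` for the VALUES `Φ j x` with equations
`B_j X_j − A_j = 0`, the generators of `f` composed with `Φ`), Jacobian block-triangular with diagonal blocks
`∂_t H`, `diag B_j`, `∂_y F(Φ x₀, u(Φ x₀))`.  Size M. -/
def PresentedComp (n m : ℕ) : Prop :=
  ∀ (f : (Fin m → ℝ) → ℝ) (Φ : Fin m → (Fin n → ℝ) → ℝ) (x₀ : Fin n → ℝ) (k : ℕ) (kΦ : Fin m → ℕ),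
    MultiGenData m k f (fun j => Φ j x₀) → (∀ j, MultiGenData n (kΦ j) (Φ j) x₀) →
    (∀ j, ContinuousAt (Φ j) x₀) →
    ∃ k', MultiGenData n k' (fun x => f (fun j => Φ j x)) x₀

/-- **P4 `MonomialDivisionAt n` — closure under EXACT division by a rational coordinate hyperplane.**
If `g` is presented at `x₀`, `x₀ i = c ∈ ℚ`, and `g = (xᵢ − c)·q` near `x₀` with `q` analytic at `x₀`,
then `q` is presented at `x₀` (with `2k` generators: `u` and the RESTRICTION `u₀(x) = u(x|_{xᵢ := c})`,
which solves `F(x|_{xᵢ:=c}, ·) = 0` with the same Jacobian at `x₀`).  Proof: `F(x,y) − F(x|_{xᵢ:=c},y) =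
(xᵢ − c)Ψ`, divided differences `F⁰(x,y) − F⁰(x,y') = Φ⁰(x,y,y')(y − y')` with `Φ⁰(x₀,u x₀,u x₀) = ∂_yF`
invertible ⟹ `u − u₀ = −(xᵢ − c)·Φ⁰⁻¹Ψ`; then `G(x,u) = G⁰(x,u₀) + (xᵢ − c)(Γ·η + G¹)` and `G⁰(x,u₀ x) ≡ 0`
because `g` vanishes on the hyperplane.  Pure polynomial identities + `solutions_eq_near`.  Size M–L.
(At a point with `x₀ i ≠ c` the divisor is a unit and the statement is trivial.) -/
def MonomialDivisionAt (n : ℕ) : Prop :=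
  ∀ (k : ℕ) (g q : (Fin n → ℝ) → ℝ) (x₀ : Fin n → ℝ) (i : Fin n) (c : ℚ), x₀ i = (c : ℝ) →
    MultiGenData n k g x₀ → AnalyticAt ℝ q x₀ → (∀ᶠ x in nhds x₀, g x = (x i - (c : ℝ)) * q x) →
    ∃ k', MultiGenData n k' q x₀

/-- **P5 `SimpleRootAdjoin n` — a simple root of a monic polynomial with presented (real) coefficients is
presented** (one more generator; the kit's `originPointData_of_simple` / landed `local_of_simple` pattern).
Stated for a real root function `ρ` analytic at `x₀` with `P(x, ρ x) = 0` near `x₀` and `∂_T P(x₀, ρ x₀) ≠ 0`,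
`P = T^m + Σ a_j T^j`. Size S–M. -/
def SimpleRootAdjoin (n : ℕ) : Prop :=
  ∀ (m : ℕ) (a : Fin m → (Fin n → ℝ) → ℝ) (ka : Fin m → ℕ) (ρ : (Fin n → ℝ) → ℝ) (x₀ : Fin n → ℝ),
    (∀ j, MultiGenData n (ka j) (a j) x₀) → AnalyticAt ℝ ρ x₀ →
    (∀ᶠ x in nhds x₀, ρ x ^ m + ∑ j : Fin m, a j x * ρ x ^ (j : ℕ) = 0) →
    ((m : ℝ) * ρ x₀ ^ (m - 1) + ∑ j : Fin m, ((j : ℕ) : ℝ) * a j x₀ * ρ x₀ ^ ((j : ℕ) - 1) ≠ 0) →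
    ∃ k', MultiGenData n k' ρ x₀

/-- `PresentedC n f x₀`: a complex-valued germ is presented when its real and imaginary parts are. -/
def PresentedC (n : ℕ) (f : (Fin n → ℝ) → ℂ) (x₀ : Fin n → ℝ) : Prop :=
  (∃ k, MultiGenData n k (fun x => (f x).re) x₀) ∧ (∃ k, MultiGenData n k (fun x => (f x).im) x₀)

/-- **P6 `HenselEtaleAt n` — Hensel's factorisation is étale** (complex form, to be realified in the
proof).  A monic `P = T^{m₁+m₂} + Σ c_j T^j` with presented complex coefficients which factors near `x₀`
as `P = Q₁·Q₂`, `Q_i` monic with coefficients analytic at `x₀` and `Q₁(x₀,·), Q₂(x₀,·)` COPRIME, has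
presented factor coefficients: the coefficient identities of `Q₁Q₂ = P` (times the denominators `B_j`)
are an étale system in the `m₁+m₂` unknown coefficients — Jacobian = Sylvester matrix of
`(Q₁(x₀,·), Q₂(x₀,·))`, determinant `= ± Res ≠ 0` by coprimality; realified determinant `|Res|² ≠ 0`.
Then `multiGenData_of_pointData` (landed P05) + `solutions_eq_near`.  Size M–L. -/
def HenselEtaleAt (n : ℕ) : Prop :=
  ∀ (m₁ m₂ : ℕ) (c : Fin (m₁ + m₂) → (Fin n → ℝ) → ℂ) (b₁ : Fin m₁ → (Fin n → ℝ) → ℂ)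
    (b₂ : Fin m₂ → (Fin n → ℝ) → ℂ) (x₀ : Fin n → ℝ),
    (∀ j, PresentedC n (c j) x₀) → (∀ j, AnalyticAt ℝ (b₁ j) x₀) → (∀ j, AnalyticAt ℝ (b₂ j) x₀) →
    (∀ᶠ x in nhds x₀, (Polynomial.X ^ m₁ + ∑ j : Fin m₁, Polynomial.C (b₁ j x) * Polynomial.X ^ (j : ℕ)) *
        (Polynomial.X ^ m₂ + ∑ j : Fin m₂, Polynomial.C (b₂ j x) * Polynomial.X ^ (j : ℕ)) =
      Polynomial.X ^ (m₁ + m₂) + ∑ j : Fin (m₁ + m₂), Polynomial.C (c j x) * Polynomial.X ^ (j : ℕ)) →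
    IsCoprime (Polynomial.X ^ m₁ + ∑ j : Fin m₁, Polynomial.C (b₁ j x₀) * Polynomial.X ^ (j : ℕ))
      (Polynomial.X ^ m₂ + ∑ j : Fin m₂, Polynomial.C (b₂ j x₀) * Polynomial.X ^ (j : ℕ)) →
    (∀ j, PresentedC n (b₁ j) x₀) ∧ (∀ j, PresentedC n (b₂ j) x₀)

/-- **C `ExponentComparabilityAt d` — the Newton-polyhedron / order-of-vanishing lemma behind the
descent**: if `σ^a e₁ + σ^b e₂ = σ^c e₃` near `p` with `e₁ e₂ e₃` analytic and nonvanishing at `p`, then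
the exponents `a, b` RESTRICTED TO `I(p) = {i : p i = 0}` are comparable and `c = min (a, b)` there when
`a ≠ b` (`c ≥ a` when `a = b`).  Proof: orders of vanishing along `σ_i = 0`, `σ_j = 0` and along the
diagonal curve `σ_i = σ_j = t` (one-variable `AnalyticAt.order`).  Size M. -/
def ExponentComparabilityAt (d : ℕ) : Prop :=
  ∀ (p : Fin d → ℝ) (a b c : Fin d → ℕ) (e₁ e₂ e₃ : (Fin d → ℝ) → ℂ),
    AnalyticAt ℝ e₁ p → AnalyticAt ℝ e₂ p → AnalyticAt ℝ e₃ p → e₁ p ≠ 0 → e₂ p ≠ 0 → e₃ p ≠ 0 →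
    (∀ᶠ σ in nhds p, (∏ i, ((σ i : ℝ) : ℂ) ^ a i) * e₁ σ + (∏ i, ((σ i : ℝ) : ℂ) ^ b i) * e₂ σ =
      (∏ i, ((σ i : ℝ) : ℂ) ^ c i) * e₃ σ) →
    ((∀ i, p i = 0 → a i ≤ b i) ∧ (∀ i, p i = 0 → c i = a i)) ∨
    ((∀ i, p i = 0 → b i ≤ a i) ∧ (∀ i, p i = 0 → c i = b i)) ∨
    ((∀ i, p i = 0 → a i = b i) ∧ (∀ i, p i = 0 → a i ≤ c i))

/-- **D₀ `ClusterDescentAt d` — the descent at ONE point (the induction carrier; complex clusters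
allowed).**  A finite family of root germs `ζ_l` analytic at `p` whose elementary symmetric functions
(the coefficients of `∏ (T − ζ_l)`) are presented at `p` and whose pairwise differences are of monomial
type at `p` (`ζ_l − ζ_l' = σ^{b l l'} · e`, `e` analytic, `e p ≠ 0`) consists of presented germs.
Induction on the cluster size `m`, steps (i)–(vi) of `QuasiOrdinaryDescent`; uses C, P1–P4, P6. -/
def ClusterDescentAt (d : ℕ) : Prop :=
  ∀ (m : ℕ) (p : Fin d → ℝ) (ζ : Fin m → (Fin d → ℝ) → ℂ) (b : Fin m → Fin m → Fin d → ℕ),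
    (∀ l, AnalyticAt ℝ (ζ l) p) →
    (∀ j : ℕ, PresentedC d (fun σ => (∏ l : Fin m, (Polynomial.X - Polynomial.C (ζ l σ))).coeff j) p) →
    (∀ l l', l ≠ l' → ∃ e : (Fin d → ℝ) → ℂ, AnalyticAt ℝ e p ∧ e p ≠ 0 ∧
      ∀ᶠ σ in nhds p, ζ l σ - ζ l' σ = (∏ i, ((σ i : ℝ) : ℂ) ^ b l l' i) * e σ) →
    ∀ l, PresentedC d (ζ l) p

/-- **D `QuasiOrdinaryDescent d` — THE DESCENT LEMMA (étale presentation of Abhyankar–Jung root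
functions).**  A monic `P = T^m + Σ a_k T^k` with REAL coefficients presented at every point of the closed
cube of `ℝᵈ` (the `σ`-cube, after ramification), split on an open `V ⊇ cube` as `∏ (T − ζ_l σ)` with
`ζ_l : ℝᵈ → ℂ` analytic (output format of the landed Abhyankar–Jung theorem `hAJ`) and with ROOT
DIFFERENCES OF MONOMIAL TYPE `ζ_l − ζ_l' = σ^{b l l'} · e_{l l'}`, `e` analytic and zero-free on `V`
(output format of the landed divisor lemma `hDIV`), has all `Re ζ_l`, `Im ζ_l` presented at every point of
the closed cube.  PROOF (induction on cluster size `m`, at a point `p`): `m = 1`: `ζ = −a₀`.  `m ≥ 2`: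
(i) the exponents at a common vertex are pairwise comparable and a global minimum `b_min = b l₀ l₀'` exists
(sum of two monomial×unit terms is monomial×unit only if comparable — Newton polyhedron); (ii) Tschirnhaus:
`η_l = ζ_l − ζ̄`, `ζ̄ = −a_{m−1}/m` presented; `η_l = (1/m) Σ_{l'} (ζ_l − ζ_l')` is divisible by `σ^{b_min}`;
(iii) `θ_l = η_l/σ^{b_min}` are the roots of the monic `Q` with coefficients `ã_{m−j}/σ^{j·b_min}` —
analytic (symmetric in the `θ`), hence PRESENTED by `MonomialDivisionAt` (coordinatewise; coordinates not
vanishing at `p` are units); (iv) `θ_{l₀}(p) − θ_{l₀'}(p) = e(p) ≠ 0`: the cluster SPLITS at `p` into `≥ 2`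
value classes `S_c = {l : θ_l(p) = c}`; (v) `Q = ∏_c Q_c`, `Q_c = ∏_{l ∈ S_c} (T − θ_l)`, pairwise coprime
at `p` ⟹ coefficients of each `Q_c` presented by `HenselEtaleAt` (realified for non-real `c`); (vi) recurse
on each `S_c` (`|S_c| < m`; differences `θ_l − θ_l' = σ^{b l l' − b_min}·unit` keep the format).  Uses only
C, P1–P4, P6 (pointwise form `ClusterDescentAt`, then read off on the closed cube).  Size L.  This
replaces Artin–Mazur (33042) for the integrands of the Jung line. -/
def QuasiOrdinaryDescent (d : ℕ) : Prop :=
  ∀ (m : ℕ) (V : Set (Fin d → ℝ)) (a : Fin m → (Fin d → ℝ) → ℝ) (ζ : Fin m → (Fin d → ℝ) → ℂ)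
    (b : Fin m → Fin m → Fin d → ℕ) (e : Fin m → Fin m → (Fin d → ℝ) → ℂ),
    IsOpen V → Set.pi Set.univ (fun _ : Fin d => Set.Icc (0:ℝ) 1) ⊆ V →
    (∀ k, AnalyticOnNhd ℝ (a k) V) → (∀ k, PresentedOnCube d (a k)) →
    (∀ l, AnalyticOnNhd ℝ (ζ l) V) →
    (∀ σ ∈ V, (Polynomial.X ^ m + ∑ k : Fin m, Polynomial.C (a k σ) * Polynomial.X ^ (k : ℕ)).map
        (algebraMap ℝ ℂ) = ∏ l, (Polynomial.X - Polynomial.C (ζ l σ))) →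
    (∀ l l', l ≠ l' → AnalyticOnNhd ℝ (e l l') V) → (∀ l l', l ≠ l' → ∀ σ ∈ V, e l l' σ ≠ 0) →
    (∀ l l', l ≠ l' → ∀ σ ∈ V, ζ l σ - ζ l' σ = (∏ i, ((σ i : ℝ) : ℂ) ^ b l l' i) * e l l' σ) →
    ∀ l, PresentedOnCube d (fun σ => (ζ l σ).re) ∧ PresentedOnCube d (fun σ => (ζ l σ).im)

/-- **G `JacobianPresented n` — closure under implicit partial derivatives** (for `det DΦ` of presented
charts): `∂u/∂xᵢ = −(∂_yF)⁻¹ ∂_{xᵢ}F` (adjugate/determinant), so partial derivatives of a presented germ are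
presented.  Size M. -/
def JacobianPresented (n : ℕ) : Prop :=
  ∀ (k : ℕ) (g : (Fin n → ℝ) → ℝ) (x₀ : Fin n → ℝ) (i : Fin n), MultiGenData n k g x₀ → AnalyticAt ℝ g x₀ →
    ∃ k', MultiGenData n k' (fun x => fderiv ℝ g x (Pi.single i 1)) x₀

/-- **Item 26437 `CubeEtaleGlue` CLOSED** — the route decl (rev 14, δ-expansion of `PiRationalisationEtale → EtaleCoverAt n g → PiRatAt n s`
for every closed-unit-cube representation `s` with integrand `g`), literally, by `piRatAt_of_etaleCoverAt` (lens-2 g10; grid the cube, treat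
every box by the CLOSED item 29429, `K₀ = max`; critic decomp-kz-crit-1 g4 CLEARED row g4-1, writer deltaG := Iff.rfl). -/
theorem cubeEtaleGlue_proof :
    Summit.KontsevichZagierPeriods.KontsevichZagierPeriods.Theses.RootDecompRationalCubeDichotomy.CubeEtaleGlue :=
  fun hE n g s hsd hsg hc => piRatAt_of_etaleCoverAt (n := n) (g := g) hE s hsd hsg hc

end Summit.KontsevichZagierPeriods.RootDecompRationalCubeDichotomy.Rung24903.EtaleBypass

end

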